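import Mathlib
import Literature.MathematicalPhysics.QuantumFieldTheory.Balaban1983to89.Beta.GaugeFixing

/-!
# `Balaban1983to89.Beta.TreeSliceUnipotent` — a block-TREE gauge slice is UNIPOTENT along the residual gauge orbit:
# `|det(τ_tree · D_B ↾ 𝔫)| = 1` for EVERY background (finite-dimensional linear algebra, [folklore], kernel-checked; no facts)

β sub-cell of the audit cell `pub-balaban` (unit `b2b-balaban-strat-b14`, [III]-side CO-LEAD, gen 21; journal node
III-R29-TREE-UNIPOTENT).  HONEST FRAMING (cell rule, verbatim): discharging `BetaPertH` makes Bałaban's UV stability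
UNCONDITIONAL — a real constructive-QFT result; it is NOT the continuum limit and NOT the Clay problem.  THIS MODULE DISCHARGES
NOTHING of the series and asserts nothing printed by Bałaban: it proves, over Mathlib, the one linear-algebra fact that the
sibling module `Beta.GaugeFixing` (unit `b2b-balaban-pv25`) leaves as the HYPOTHESIS `h1 : ∀ᶠ B in nhds 0, |(P B * W B).det| = 1`
of its theorem II″ `polarization_withSlice_eq_add_of_abs_det_eq_one` («II″ for a UNIPOTENT second slice (`|det(P(B)W(B))| = 1`
near `0`, e.g. a slice that is block-triangular along the directions with unimodular diagonal blocks)»), for the class of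
slices that READ THE FIELD ON THE BONDS OF A ROOTED FOREST (block trees rooted at the block centres) composed with a
linearised orbit map whose value on a bond is «(value at one end) − (transported value at the other end)» with a
unimodular transport.  Value = kernel identity (the «e.g.» of II″ made a theorem), NOT summit progress.

v1.1 (same seat, APPEND-ONLY, no new import): + §5 the BASIS-FREE form `abs_linearMapDet_eq_one_of_forest_formula` —
`|LinearMap.det f| = 1` for ANY endomorphism `f` of the residual parameters `X → κ → ℝ` acting by the forest formula — so that a
letter-level consumer (an2's route-(α) leaf `AxialProjector`, RULING (R29-5): «per-block unipotency |det(τ_tree·D_B↾𝔫_ev)| = 1»)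
binds the lemma by exhibiting a pointwise formula, with no matrix bookkeeping of its own; + §6 the same over an ABSTRACT
finite-dimensional real fibre `V` (`abs_linearMapDet_eq_one_of_forest_formula'`: parameters `X → V`, transports `Ax x : V →ₗ V` with
`|LinearMap.det| = 1`, e.g. `Ad(U_b(B))` on `𝔤`).  v1 declarations byte-identical.

v1.2 (same seat, APPEND-ONLY, no new import): + §7 the IDENT-122 (D-e) clause for a forest slice — its Faddeev–Popov LOGARITHM is
identically `0` (`log_abs_det_eq_zero_of_forest`), hence `hessianAt (B ↦ log|det(P B * W B)|) i j = 0`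
(`hessianAt_log_abs_det_eq_zero_of_forest`, via `hessianAt_const`) and it is trivially `C^m` at `0` (`contDiffAt_log_abs_det_of_forest`);
+ §8 NESTED FORESTS COMPOSE (`composeParent`, `composeRank`, `composeParent_rank_lt`, `abs_det_forestMatrix_compose_eq_one`): fine
trees rooted at the vertices of a coarse forest form a rank-decreasing forest, so a COMPOSED (two-level, inductively m-level) tree
slice is unipotent by the same headline.  v1/v1.1 declarations byte-identical.

v1.3 (same seat, APPEND-ONLY, no new import): + §9 BAŁABAN'S COMB FOREST ON ONE BLOCK as concrete data (`CombVertex d L` =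
non-zero offsets `Fin d → Fin L`, `combParent` = lower the lowest-index non-zero coordinate = the predecessor on the axial contour
`Γ_{y,x}` of an1's `AveragingContours.axial`, `combRank` = `ℓ¹` length, `combParent_rank_lt`, `combRank_pos`) and the per-block
unipotency `abs_det_forestMatrix_comb_eq_one` / `abs_linearMapDet_eq_one_of_comb_formula`.  Earlier declarations byte-identical.

v1.4 (unit gen 22, APPEND-ONLY, no new import): + §10 HIERARCHY, the combinatorial skeleton of route (α) item (A4) (hierarchical `Π`):
`composeParent_rank_lt_shift` / `abs_det_forestMatrix_compose_eq_one'` (the §8 headline WITHOUT the positivity side condition `hpos`,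
by the rank shift `rk₁ + 1` — XREAD C-pv10-103 INFO I1); REPLICATED fine forests over the cells of a coarse forest (`replicateParent`,
`cellCtr`, `hierParent`, `hierRank`, `hierParent_rank_lt`, shape lemmas `hierParent_inl_of_some` / `_inl_of_none_some` / `_inl_of_none_none` /
`hierParent_inr`, `abs_det_forestMatrix_hier_eq_one`, `abs_linearMapDet_eq_one_of_hier_formula`) = the inductive step «level `m` →
`m+1`»; and the `m`-LEVEL COMB TOWER by recursion (`TowerVertex`, `towerParent`, `towerRank`, `towerParent_rank_lt`,
`card_combVertex_succ`, `card_towerVertex_succ`, `towerParent_one` = the two-level comb, `abs_det_forestMatrix_tower_eq_one`,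
`abs_linearMapDet_eq_one_of_tower_formula`).  Earlier declarations byte-identical.

CITATION HEADER (lean-in-tree rule 2026-08-18).  The two gauge fixings whose comparison this serves are fixed by the sibling's
header (quotations there, not repeated): T. Bałaban, *Renormalization group approach to lattice gauge field theories. I*,
Commun. Math. Phys. **109** (1987) 249–301 [Balaban1987RG1], p. 254 (0.14) (exponential gauge fixing; residual group
«u(y) = 1 for y ∈ T^{(1)}»), p. 255 («the integral over u is equal to 1»); T. Bałaban, *Propagators for lattice gauge theories
in a background field*, Commun. Math. Phys. **99** (1985) 389–434 [Balaban1985BackgroundPropagators], p. 428 (3.156) («B = 0 on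
∪_{y∈Λ′} Ax(y)» — the δ/axial SLICE on the block trees).  Nothing of either paper is used as a hypothesis-free fact; the
present file is about matrices.

THE MODEL (finite-dimensional; all types finite).
* `X` = the NON-ROOT vertices (sites other than block centres); the residual gauge parameters are `λ : X → (κ → ℝ)` (`κ` = a
  basis of the colour algebra), extended by `0` at the roots — so a column index is a pair `(y, j) : X × κ`.
* A rooted forest on the sites is given by `parent : X → Option X` (`none` = the parent is a root) which STRICTLY DECREASES a
  rank `rk : X → ℕ` (tree depth): `parent x = some y → rk y < rk x`.  One tree bond `b_x` per non-root vertex `x` (the bond to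
  its parent), so a row index is again a pair `(x, i) : X × κ`.
* `forestMatrix parent C A : Matrix (X × κ) (X × κ) ℝ`, block `(x, y)` = `C x` if `y = parent x`, `− A x` if `y = x`, `0`
  otherwise: the tree slice composed with a linearised orbit map reading, on the bond `b_x`, «`C x`·(value at the parent) −
  `A x`·(value at `x`)».  For Bałaban's `(D_B λ)_b = λ(x) − Ad(U_b(B)) λ(x′)` on `b = ⟨x, x′⟩` and a tree bond oriented parent →
  child this is `C x = 1`, `A x = Ad(U_{b_x}(B))` (orthogonal, hence unimodular); for the opposite orientation `C x = −Ad(U_{b_x}(B))`,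
  `A x = −1` — both covered, since `C` is ARBITRARY below and only `|det (A x)| = 1` is asked.
* §3 factors the same matrix as `treeSlice (κ := κ) tb * orbitMap src tgt S T` (slice = read the tree bonds `tb x`; orbit map on ALL
  bonds `β`, `(D λ)_b = S_b λ(src b) − T_b λ(tgt b)`), in the parent → child orientation `tgt (tb x) = some x`.

WHAT IS PROVED (all [folklore]; `0` sorry, no `def … : Prop`):
* §1 `abs_det_eq_one_of_blockTriangular`: a block-triangular real matrix whose diagonal blocks have `|det| = 1` has `|det| = 1`
  (Mathlib `Matrix.BlockTriangular.det`); `abs_det_neg`; `abs_det_eq_one_of_transpose_mul_self_eq_one` / `…_of_mul_transpose_self…`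
  (orthogonal ⇒ unimodular).
* §2 `forestMatrix_blockTriangular` (block-triangular by tree depth), `toSquareBlock_forestMatrix` (the depth-`d` diagonal block
  is `blockDiagonal (x ↦ −A x)` over the vertices of depth `d`, up to reindexing), and the headline
  `abs_det_forestMatrix_eq_one : (∀ x y, parent x = some y → rk y < rk x) → (∀ x, |(A x).det| = 1) → |(forestMatrix parent C A).det| = 1`.
* §3 `treeSlice_mul_orbitMap` and `abs_det_treeSlice_mul_orbitMap_eq_one` (the factored form), and the reindexed /
  background-family forms `abs_det_eq_one_of_eq_reindex_forestMatrix`, `eventually_abs_det_eq_one_of_forest` delivering the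
  sibling's hypothesis `h1` VERBATIM (`∀ᶠ B in nhds 0, |(P B * W B).det| = 1`) from a pointwise factorisation through a forest matrix.
* §5 (v1.1) `toLin'_forestMatrix_apply`, `abs_linearMapDet_eq_one_of_forest_formula` (+ `_orthogonal`, `isUnit_linearMapDet_of_forest_formula`):
  the basis-free form over `Module.End ℝ (X → κ → ℝ)` via `LinearEquiv.curry`, `LinearMap.det_conj`, `LinearMap.det_toLin'`.
* §6 (v1.1) `abs_linearMapDet_eq_one_of_forest_formula'`: the same over `Module.End ℝ (X → V)`, `V` any finite-dimensional real vector
  space, via `Module.finBasis`, `LinearEquiv.piCongrRight`, `LinearMap.toMatrix_mulVec_repr`, `LinearMap.det_toMatrix`.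
* §7 (v1.2) `log_abs_det_eq_zero_of_forest`, `log_abs_det_forest_eq_zero_fun`, `hessianAt_const`,
  `hessianAt_log_abs_det_eq_zero_of_forest`, `contDiffAt_log_abs_det_of_forest`.
* §8 (v1.2) `composeParent`, `composeRank`, `composeParent_rank_lt`, `abs_det_forestMatrix_compose_eq_one`.
* §9 (v1.3) `CombVertex`, `nzCoords`, `lowIdx`, `combPred`, `combParent`, `combRank`, `combRank_pos`, `sum_combPred`,
  `combParent_rank_lt`, `abs_det_forestMatrix_comb_eq_one`, `abs_linearMapDet_eq_one_of_comb_formula`.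
* §10 (v1.4) `composeParent_rank_lt_shift`, `abs_det_forestMatrix_compose_eq_one'`; `replicateParent`, `cellCtr`, `hierParent`,
  `hierRank`, `replicateParent_eq_some_iff`, `hierParent_inl_of_some`, `hierParent_inl_of_none_some`, `hierParent_inl_of_none_none`,
  `hierParent_inr`, `hierParent_rank_lt`, `abs_det_forestMatrix_hier_eq_one`, `abs_linearMapDet_eq_one_of_hier_formula`; `TowerVertex`
  (+ `Fintype`/`DecidableEq` instances by recursion), `towerParent`, `towerRank`, `towerParent_zero/succ/one`, `towerRank_zero/succ`,
  `towerParent_rank_lt`, `card_combVertex_succ`, `card_towerVertex_succ`, `abs_det_forestMatrix_tower_eq_one`,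
  `abs_linearMapDet_eq_one_of_tower_formula`.
WHAT IS NOT CLAIMED: which concrete slice of which cell row factors this way (that row's to state: SLICE-FP-NOTE (7.4) CHECK
ITEM (D-h)); nothing about the weak-Landau slice (whose Faddeev–Popov determinant is NOT constant in `B`); nothing of the series.
-/

namespace Literature.MathematicalPhysics.QuantumFieldTheory.Balaban1983to89.Beta.TreeSliceUnipotent

open Matrix

/-! ## §1. Unimodular block-triangular matrices -/

section Abstract

variable {m α : Type*} [Fintype m] [DecidableEq m] [DecidableEq α] [LinearOrder α]

/-- A block-triangular real matrix all of whose diagonal blocks have `|det| = 1` has `|det| = 1`. [folklore] -/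
theorem abs_det_eq_one_of_blockTriangular (M : Matrix m m ℝ) (b : m → α) (hM : M.BlockTriangular b)
    (h1 : ∀ k ∈ Finset.univ.image b, |(M.toSquareBlock b k).det| = 1) : |M.det| = 1 := by
  rw [hM.det, Finset.abs_prod]
  exact Finset.prod_eq_one h1

omit [DecidableEq α] [LinearOrder α] in
/-- `|det (−A)| = |det A|`. [folklore] -/
theorem abs_det_neg (A : Matrix m m ℝ) : |(-A).det| = |A.det| := by
  rw [det_neg, abs_mul, abs_pow, abs_neg, abs_one, one_pow, one_mul]

omit [DecidableEq α] [LinearOrder α] in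
/-- An orthogonal matrix (`Aᵀ A = 1`) is unimodular: `|det A| = 1`. [folklore] -/
theorem abs_det_eq_one_of_transpose_mul_self_eq_one (A : Matrix m m ℝ) (h : Aᵀ * A = 1) : |A.det| = 1 := by
  have h2 : A.det * A.det = 1 := by
    have := congrArg Matrix.det h
    rwa [det_mul, det_transpose, det_one] at this
  have h3 : |A.det| * |A.det| = 1 := by rw [← abs_mul, h2, abs_one]
  rcases mul_self_eq_one_iff.mp h3 with h4 | h4
  · exact h4
  · exact absurd h4 (by have := abs_nonneg A.det; linarith)

omit [DecidableEq α] [LinearOrder α] in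
/-- An orthogonal matrix (`A Aᵀ = 1`) is unimodular: `|det A| = 1`. [folklore] -/
theorem abs_det_eq_one_of_mul_transpose_self_eq_one (A : Matrix m m ℝ) (h : A * Aᵀ = 1) : |A.det| = 1 := by
  have h2 : A.det * A.det = 1 := by
    have := congrArg Matrix.det h
    rwa [det_mul, det_transpose, det_one] at this
  have h3 : |A.det| * |A.det| = 1 := by rw [← abs_mul, h2, abs_one]
  rcases mul_self_eq_one_iff.mp h3 with h4 | h4
  · exact h4
  · exact absurd h4 (by have := abs_nonneg A.det; linarith)

end Abstract

/-! ## §2. The forest matrix: tree slice ∘ linearised orbit map, block-triangular by depth -/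

section Forest

variable {X κ : Type*} [DecidableEq X]

/-- The FOREST MATRIX of a rooted forest `parent : X → Option X` on the non-root vertices `X` (`none` = the parent is a root),
with end matrices `C A : X → Matrix κ κ ℝ`: rows = tree bonds `b_x` (one per non-root vertex `x`), columns = residual gauge
parameters at the non-root vertices; block `(x, y)` = `C x` if `y = parent x`, minus `A x` if `y = x`.  It is the matrix of
`λ ↦ (b_x ↦ C x · λ(parent x) − A x · λ(x))` with `λ(root) = 0`. [folklore] -/
def forestMatrix (parent : X → Option X) (C A : X → Matrix κ κ ℝ) : Matrix (X × κ) (X × κ) ℝ :=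
  Matrix.of fun p q =>
    (if parent p.1 = some q.1 then C p.1 p.2 q.2 else 0) - (if q.1 = p.1 then A p.1 p.2 q.2 else 0)

/-- Entry formula of `forestMatrix`. [folklore] -/
theorem forestMatrix_apply (parent : X → Option X) (C A : X → Matrix κ κ ℝ) (p q : X × κ) :
    forestMatrix parent C A p q =
      (if parent p.1 = some q.1 then C p.1 p.2 q.2 else 0) - (if q.1 = p.1 then A p.1 p.2 q.2 else 0) := rfl

/-- The depth label: minus the rank of the vertex (so that parents come AFTER children). [folklore] -/
def depthLabel (rk : X → ℕ) : X × κ → ℤ := fun p => -(rk p.1 : ℤ)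

omit [DecidableEq X] in
/-- Entry formula of `depthLabel`. [folklore] -/
@[simp] theorem depthLabel_apply (rk : X → ℕ) (p : X × κ) : depthLabel (κ := κ) rk p = -(rk p.1 : ℤ) := rfl

/-- The forest matrix is block-triangular with respect to tree depth: a non-zero block `(x, y)` has `y = x` or
`y = parent x`, and `rk (parent x) < rk x`. [folklore] -/
theorem forestMatrix_blockTriangular (parent : X → Option X) (C A : X → Matrix κ κ ℝ) (rk : X → ℕ)
    (hrk : ∀ x y, parent x = some y → rk y < rk x) :
    (forestMatrix parent C A).BlockTriangular (depthLabel (κ := κ) rk) := by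
  intro p q hlt
  simp only [depthLabel_apply, neg_lt_neg_iff, Nat.cast_lt] at hlt
  -- hlt : rk p.1 < rk q.1
  have hne1 : parent p.1 ≠ some q.1 := fun hp => by have := hrk _ _ hp; omega
  have hne2 : q.1 ≠ p.1 := fun hq => by rw [hq] at hlt; exact lt_irrefl _ hlt
  simp [forestMatrix_apply, hne1, hne2]

omit [DecidableEq X] in
/-- The reindexing of a depth block: `κ × {vertices of the given depth} ≃ {row/column indices of the given depth}`. [folklore] -/
def depthBlockEquiv (rk : X → ℕ) (k : ℤ) :
    (κ × {x : X // -(rk x : ℤ) = k}) ≃ {p : X × κ // depthLabel (κ := κ) rk p = k} where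
  toFun := fun ix => ⟨(ix.2.1, ix.1), ix.2.2⟩
  invFun := fun p => (p.1.2, ⟨p.1.1, p.2⟩)
  left_inv := fun _ => rfl
  right_inv := fun _ => rfl

variable [Fintype X] [Fintype κ] [DecidableEq κ]

omit [Fintype X] [Fintype κ] [DecidableEq κ] in
/-- The depth-`k` diagonal block of the forest matrix is, up to the reindexing `depthBlockEquiv`, the block-DIAGONAL matrix
`blockDiagonal (x ↦ −A x)` over the vertices of that depth (a parent never has the depth of its child). [folklore] -/
theorem toSquareBlock_forestMatrix (parent : X → Option X) (C A : X → Matrix κ κ ℝ) (rk : X → ℕ)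
    (hrk : ∀ x y, parent x = some y → rk y < rk x) (k : ℤ) :
    (forestMatrix parent C A).toSquareBlock (depthLabel (κ := κ) rk) k =
      Matrix.reindex (depthBlockEquiv rk k) (depthBlockEquiv rk k)
        (blockDiagonal fun x : {x : X // -(rk x : ℤ) = k} => -A x.1) := by
  ext ⟨p, hp⟩ ⟨q, hq⟩
  simp only [depthLabel_apply] at hp hq
  have hne1 : parent p.1 ≠ some q.1 := fun h => by have := hrk _ _ h; omega
  simp only [toSquareBlock_def, Matrix.of_apply, forestMatrix_apply, Matrix.reindex_apply, Matrix.submatrix_apply,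
    blockDiagonal_apply, depthBlockEquiv, Equiv.coe_fn_symm_mk, Matrix.neg_apply, Subtype.mk.injEq, hne1, if_false,
    zero_sub]
  by_cases hqp : q.1 = p.1
  · rw [if_pos hqp, if_pos hqp.symm]
  · rw [if_neg hqp, if_neg (Ne.symm hqp), neg_zero]

/-- HEADLINE.  The forest matrix of a rank-decreasing rooted forest with unimodular child-end matrices `A x` is unimodular:
`|det| = 1` — whatever the parent-end matrices `C x` are (block-triangular in tree depth, diagonal blocks `−A x`).  This is the
linear-algebra content of «a block-tree gauge slice is unipotent along the residual orbit for EVERY background». [folklore] -/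
theorem abs_det_forestMatrix_eq_one (parent : X → Option X) (C A : X → Matrix κ κ ℝ) (rk : X → ℕ)
    (hrk : ∀ x y, parent x = some y → rk y < rk x) (hA : ∀ x, |(A x).det| = 1) :
    |(forestMatrix parent C A).det| = 1 := by
  apply abs_det_eq_one_of_blockTriangular _ (depthLabel (κ := κ) rk) (forestMatrix_blockTriangular parent C A rk hrk)
  intro k _
  rw [toSquareBlock_forestMatrix parent C A rk hrk k, det_reindex_self, det_blockDiagonal, Finset.abs_prod]
  exact Finset.prod_eq_one fun x _ => by rw [abs_det_neg, hA]

/-- The same with orthogonal child-end matrices (`(A x)ᵀ A x = 1`, e.g. `Ad(U_b(B))` in an orthonormal basis of the colour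
algebra for the Killing form). [folklore] -/
theorem abs_det_forestMatrix_eq_one_of_orthogonal (parent : X → Option X) (C A : X → Matrix κ κ ℝ) (rk : X → ℕ)
    (hrk : ∀ x y, parent x = some y → rk y < rk x) (hA : ∀ x, (A x)ᵀ * A x = 1) :
    |(forestMatrix parent C A).det| = 1 :=
  abs_det_forestMatrix_eq_one parent C A rk hrk fun x => abs_det_eq_one_of_transpose_mul_self_eq_one _ (hA x)

/-- In particular the forest matrix is invertible (admissibility of the tree slice: `τ W` invertible). [folklore] -/
theorem isUnit_det_forestMatrix (parent : X → Option X) (C A : X → Matrix κ κ ℝ) (rk : X → ℕ)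
    (hrk : ∀ x y, parent x = some y → rk y < rk x) (hA : ∀ x, |(A x).det| = 1) :
    IsUnit (forestMatrix parent C A).det := by
  rw [isUnit_iff_ne_zero]
  intro h
  have := abs_det_forestMatrix_eq_one parent C A rk hrk hA
  rw [h, abs_zero] at this
  exact zero_ne_one this

end Forest

/-! ## §3. The factored form `treeSlice * orbitMap`, and the sibling's hypothesis `h1` verbatim -/

section SliceOrbit

variable {X β κ : Type*} [DecidableEq X] [DecidableEq β] [DecidableEq κ]

omit [DecidableEq β] [DecidableEq κ] in
/-- The LINEARISED ORBIT MAP on all bonds `β`: bond `b` runs from `src b` to `tgt b` (`none` = a root, where the parameter is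
`0`), and `(D λ)_b = S_b · λ(src b) − T_b · λ(tgt b)` (Bałaban: `S_b = 1`, `T_b = Ad(U_b(B))`). [folklore] -/
def orbitMap (src tgt : β → Option X) (S T : β → Matrix κ κ ℝ) : Matrix (β × κ) (X × κ) ℝ :=
  Matrix.of fun r q =>
    (if src r.1 = some q.1 then S r.1 r.2 q.2 else 0) - (if tgt r.1 = some q.1 then T r.1 r.2 q.2 else 0)

omit [DecidableEq β] [DecidableEq κ] in
/-- Entry formula of `orbitMap`. [folklore] -/
theorem orbitMap_apply (src tgt : β → Option X) (S T : β → Matrix κ κ ℝ) (r : β × κ) (q : X × κ) :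
    orbitMap src tgt S T r q =
      (if src r.1 = some q.1 then S r.1 r.2 q.2 else 0) - (if tgt r.1 = some q.1 then T r.1 r.2 q.2 else 0) := rfl

/-- The TREE SLICE: read the bond field on the tree bonds `tb x`, one per non-root vertex `x` (the δ-gauge setting the field to
zero on the block trees, as a linear map bond-fields → (tree bonds) × colours). [folklore] -/
def treeSlice (tb : X → β) : Matrix (X × κ) (β × κ) ℝ :=
  Matrix.of fun p r => if r = (tb p.1, p.2) then 1 else 0

omit [DecidableEq X] in
/-- Entry formula of `treeSlice`. [folklore] -/
theorem treeSlice_apply (tb : X → β) (p : X × κ) (r : β × κ) :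
    treeSlice (κ := κ) tb p r = if r = (tb p.1, p.2) then 1 else 0 := rfl

variable [Fintype X] [Fintype β] [Fintype κ]

omit [Fintype X] in
/-- Tree slice ∘ orbit map = the forest matrix, in the orientation «tree bond `tb x` ENDS at `x`» (parent → child):
`parent x := src (tb x)`, `C x := S (tb x)`, `A x := T (tb x)`. [folklore] -/
theorem treeSlice_mul_orbitMap (tb : X → β) (src tgt : β → Option X) (S T : β → Matrix κ κ ℝ)
    (htgt : ∀ x, tgt (tb x) = some x) :
    treeSlice (κ := κ) tb * orbitMap src tgt S T =
      forestMatrix (fun x => src (tb x)) (fun x => S (tb x)) (fun x => T (tb x)) := by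
  ext p q
  rw [Matrix.mul_apply, forestMatrix_apply]
  rw [Finset.sum_eq_single (tb p.1, p.2)]
  · rw [treeSlice_apply, if_pos rfl, one_mul, orbitMap_apply, htgt]
    simp only [Option.some.injEq]
    by_cases h : p.1 = q.1
    · rw [if_pos h, if_pos h.symm]
    · rw [if_neg h, if_neg (Ne.symm h)]
  · intro r _ hr
    rw [treeSlice_apply, if_neg hr, zero_mul]
  · intro h
    exact absurd (Finset.mem_univ _) h

/-- HEADLINE, factored form.  If the tree bonds end at their vertex, start at the parent (a root or a vertex of smaller
rank), and the end transports are unimodular, then `|det (treeSlice · orbitMap)| = 1` — for every choice of the start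
matrices and of the transports on the non-tree bonds. [folklore] -/
theorem abs_det_treeSlice_mul_orbitMap_eq_one (tb : X → β) (src tgt : β → Option X) (S T : β → Matrix κ κ ℝ)
    (rk : X → ℕ) (htgt : ∀ x, tgt (tb x) = some x) (hsrc : ∀ x y, src (tb x) = some y → rk y < rk x)
    (hT : ∀ x, |(T (tb x)).det| = 1) :
    |(treeSlice (κ := κ) tb * orbitMap src tgt S T).det| = 1 := by
  rw [treeSlice_mul_orbitMap tb src tgt S T htgt]
  exact abs_det_forestMatrix_eq_one _ _ _ rk hsrc hT

end SliceOrbit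

/-! ### The sibling's hypothesis `h1` of `GaugeFixing.polarization_withSlice_eq_add_of_abs_det_eq_one`, verbatim -/

section Delivery

variable {X κ : Type*} [Fintype X] [DecidableEq X] [Fintype κ] [DecidableEq κ]
variable {r : ℕ}

/-- Reindexed form: a square matrix that IS a forest matrix up to a simultaneous reindexing of rows and columns is
unimodular. [folklore] -/
theorem abs_det_eq_one_of_eq_reindex_forestMatrix (M : Matrix (Fin r) (Fin r) ℝ) (e : X × κ ≃ Fin r)
    (parent : X → Option X) (C A : X → Matrix κ κ ℝ) (rk : X → ℕ)
    (hrk : ∀ x y, parent x = some y → rk y < rk x) (hA : ∀ x, |(A x).det| = 1)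
    (hM : M = Matrix.reindex e e (forestMatrix parent C A)) : |M.det| = 1 := by
  rw [hM, det_reindex_self]
  exact abs_det_forestMatrix_eq_one parent C A rk hrk hA

variable {ι : Type*} {n : ℕ}

/-- BACKGROUND FAMILIES.  If for every background `B` the product `P B * W B` (slice × gauge directions, the sibling's
notation) is, up to one fixed reindexing, the forest matrix of one fixed rank-decreasing forest with `B`-dependent end
matrices whose child ends are unimodular, then `|det (P B * W B)| = 1` for every `B` — in particular EVENTUALLY near `0`,
which is the hypothesis `h1` of `GaugeFixing.polarization_withSlice_eq_add_of_abs_det_eq_one` verbatim. [folklore] -/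
theorem eventually_abs_det_eq_one_of_forest [TopologicalSpace ι]
    (P : ι → Matrix (Fin r) (Fin n) ℝ) (W : ι → Matrix (Fin n) (Fin r) ℝ) (e : X × κ ≃ Fin r)
    (parent : X → Option X) (rk : X → ℕ) (hrk : ∀ x y, parent x = some y → rk y < rk x)
    (C A : ι → X → Matrix κ κ ℝ) (hA : ∀ B x, |(A B x).det| = 1)
    (hPW : ∀ B, P B * W B = Matrix.reindex e e (forestMatrix parent (C B) (A B))) (B₀ : ι) :
    ∀ᶠ B in nhds B₀, |(P B * W B).det| = 1 :=
  Filter.Eventually.of_forall fun B =>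
    abs_det_eq_one_of_eq_reindex_forestMatrix _ e parent (C B) (A B) rk hrk (hA B) (hPW B)

/-- And the admissibility clause `IsUnit (P B * W B).det` of the same theorem, for every `B`. [folklore] -/
theorem isUnit_det_of_forest (P : ι → Matrix (Fin r) (Fin n) ℝ) (W : ι → Matrix (Fin n) (Fin r) ℝ) (e : X × κ ≃ Fin r)
    (parent : X → Option X) (rk : X → ℕ) (hrk : ∀ x y, parent x = some y → rk y < rk x)
    (C A : ι → X → Matrix κ κ ℝ) (hA : ∀ B x, |(A B x).det| = 1)
    (hPW : ∀ B, P B * W B = Matrix.reindex e e (forestMatrix parent (C B) (A B))) (B : ι) :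
    IsUnit (P B * W B).det := by
  rw [isUnit_iff_ne_zero]
  intro h
  have := abs_det_eq_one_of_eq_reindex_forestMatrix _ e parent (C B) (A B) rk hrk (hA B) (hPW B)
  rw [h, abs_zero] at this
  exact zero_ne_one this

end Delivery

/-! ## §4. Plugged into the sibling: II″ for a FOREST slice (the «e.g.» of `polarization_withSlice_eq_add_of_abs_det_eq_one`
made a theorem — its hypothesis `h1` and the admissibility clause `IsUnit (P B * W B).det` are DISCHARGED by §3; every other
hypothesis is the sibling's, verbatim) -/

section PluggedIn

open Literature.MathematicalPhysics.QuantumFieldTheory.Balaban1983to89.Beta.GaugeFixing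

variable {X κ : Type*} [Fintype X] [DecidableEq X] [Fintype κ] [DecidableEq κ]
variable {ι : Type*} [Fintype ι] [DecidableEq ι] {n m r : ℕ}

/-- II″ FOR A FOREST SLICE.  In the sibling's setting (`F` a background family of constrained Gaussian data, `W B` two-sided
gauge directions with `Q(B)·W(B) = 0`, `τ` an admissible slice with nondegenerate bordered matrix, `P` a second slice), if
`P B * W B` is — up to one fixed reindexing — the forest matrix of a fixed rank-decreasing rooted forest with unimodular
child-end matrices for every `B`, then `Π_P = Π_τ + Hess₀ log|det(τ W)|` entrywise: the polarization in the FOREST (block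
tree / axial) δ-gauge equals the polarization in the `τ`-gauge PLUS the Hessian at `0` of `τ`'s Faddeev–Popov logarithm.
No regularity and no admissibility hypothesis on the `P` side remains except the `C²` one on its `log Z`. [folklore] -/
theorem polarization_withSlice_eq_add_of_forest (F : Family ι n m)
    (τ P : (ι → ℝ) → Matrix (Fin r) (Fin n) ℝ) (W : (ι → ℝ) → Matrix (Fin n) (Fin r) ℝ)
    (e : X × κ ≃ Fin r) (parent : X → Option X) (rk : X → ℕ) (hrk : ∀ x y, parent x = some y → rk y < rk x)
    (C A : (ι → ℝ) → X → Matrix κ κ ℝ) (hA : ∀ B x, |(A B x).det| = 1)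
    (hPW : ∀ B, P B * W B = Matrix.reindex e e (forestMatrix parent (C B) (A B)))
    (h : ∀ᶠ B in nhds 0, (F B).Δ * W B = 0 ∧ (F B).Δᵀ * W B = 0 ∧ (F B).Q * W B = 0 ∧ IsUnit (τ B * W B).det ∧
      (withSlice (F B) (τ B)).kkt.det ≠ 0)
    (hP : ContDiffAt ℝ 2 (Family.logZ fun B => withSlice (F B) (P B)) 0)
    (hτW : ContDiffAt ℝ 2 (fun B => Real.log |(τ B * W B).det|) 0) (i j : ι) :
    polarization (fun B => withSlice (F B) (P B)) i j =
      polarization (fun B => withSlice (F B) (τ B)) i j + hessianAt (fun B => Real.log |(τ B * W B).det|) i j := by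
  refine polarization_withSlice_eq_add_of_abs_det_eq_one F τ P W ?_
    (eventually_abs_det_eq_one_of_forest P W e parent rk hrk C A hA hPW 0) hP hτW i j
  filter_upwards [h] with B hB
  exact ⟨hB.1, hB.2.1, hB.2.2.1, hB.2.2.2.1, isUnit_det_of_forest P W e parent rk hrk C A hA hPW B, hB.2.2.2.2⟩

/-- The torus one-loop coefficient version: `β⁰_T` read in the forest gauge equals `β⁰_T` read in the `τ`-gauge for the
family whose `log Z` is SHIFTED by `τ`'s Faddeev–Popov logarithm — stated as «equal polarizations ⇒ equal `β⁰_T`» applied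
to the entrywise identity above: if `Hess₀ log|det(τ W)| = 0` entrywise (the `τ`-slice is ITSELF unipotent to second order
at `0`), the two `β⁰_T` agree. [folklore] -/
theorem torusBetaZero_withSlice_forest_eq_of_hessian_fp_zero {d s c : ℕ} [NeZero s] (F : Family (ExtIndex d s c) n m)
    (τ P : (ExtIndex d s c → ℝ) → Matrix (Fin r) (Fin n) ℝ) (W : (ExtIndex d s c → ℝ) → Matrix (Fin n) (Fin r) ℝ)
    (e : X × κ ≃ Fin r) (parent : X → Option X) (rk : X → ℕ) (hrk : ∀ x y, parent x = some y → rk y < rk x)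
    (C A : (ExtIndex d s c → ℝ) → X → Matrix κ κ ℝ) (hA : ∀ B x, |(A B x).det| = 1)
    (hPW : ∀ B, P B * W B = Matrix.reindex e e (forestMatrix parent (C B) (A B)))
    (h : ∀ᶠ B in nhds 0, (F B).Δ * W B = 0 ∧ (F B).Δᵀ * W B = 0 ∧ (F B).Q * W B = 0 ∧ IsUnit (τ B * W B).det ∧
      (withSlice (F B) (τ B)).kkt.det ≠ 0)
    (hP : ContDiffAt ℝ 2 (Family.logZ fun B => withSlice (F B) (P B)) 0)
    (hτW : ContDiffAt ℝ 2 (fun B => Real.log |(τ B * W B).det|) 0)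
    (h0 : ∀ i j, hessianAt (fun B => Real.log |(τ B * W B).det|) i j = 0) (a₀ : Fin c) (μ ν : Fin d) :
    torusBetaZero (fun B => withSlice (F B) (P B)) a₀ μ ν = torusBetaZero (fun B => withSlice (F B) (τ B)) a₀ μ ν := by
  apply torusBetaZero_eq_of_polarization_eq
  funext i j
  rw [polarization_withSlice_eq_add_of_forest F τ P W e parent rk hrk C A hA hPW h hP hτW i j, h0 i j, add_zero]

end PluggedIn

/-! ## §5. (v1.1) BASIS-FREE FORM: `|LinearMap.det f| = 1` for an endomorphism of the residual parameters given by the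
forest FORMULA (so a consumer working at letter level — functions `X → κ → ℝ`, no matrices — binds the headline by exhibiting
the pointwise formula of its «tree slice ∘ orbit map», nothing else) -/

section BasisFree

variable {X κ : Type*} [Fintype X] [DecidableEq X] [Fintype κ] [DecidableEq κ]

/-- The uncurried coordinate form of the forest formula: `Matrix.toLin' (forestMatrix parent C A)` acts on `v : X × κ → ℝ`
by `(x, i) ↦ (C x · v(parent x, ·) − A x · v(x, ·)) i` (the parent term absent at a root). [folklore] -/
theorem toLin'_forestMatrix_apply (parent : X → Option X) (C A : X → Matrix κ κ ℝ) (v : X × κ → ℝ) (p : X × κ) :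
    Matrix.toLin' (forestMatrix parent C A) v p =
      ((parent p.1).elim 0 (fun y => C p.1 *ᵥ Function.curry v y) - A p.1 *ᵥ Function.curry v p.1) p.2 := by
  rw [Matrix.toLin'_apply, Matrix.mulVec, dotProduct]
  simp_rw [forestMatrix_apply, sub_mul, Finset.sum_sub_distrib, Fintype.sum_prod_type, ite_mul, zero_mul]
  have h2 : (∑ x : X, ∑ j : κ, if x = p.1 then A p.1 p.2 j * v (x, j) else 0) =
      (A p.1 *ᵥ Function.curry v p.1) p.2 := by
    rw [Finset.sum_eq_single p.1]
    · simp only [if_true, Matrix.mulVec, dotProduct, Function.curry_apply]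
    · intro x _ hx
      simp only [if_neg hx, Finset.sum_const_zero]
    · intro h; exact absurd (Finset.mem_univ _) h
  have h1 : (∑ x : X, ∑ j : κ, if parent p.1 = some x then C p.1 p.2 j * v (x, j) else 0) =
      ((parent p.1).elim 0 (fun y => C p.1 *ᵥ Function.curry v y)) p.2 := by
    cases hp : parent p.1 with
    | none => simp
    | some y =>
      rw [Finset.sum_eq_single y]
      · simp only [if_true, Option.elim, Matrix.mulVec, dotProduct, Function.curry_apply]
      · intro x _ hx
        have : ¬ (some y = some x) := fun h => hx (Option.some.inj h).symm
        simp only [if_neg this, Finset.sum_const_zero]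
      · intro h; exact absurd (Finset.mem_univ _) h
  rw [h1, h2, Pi.sub_apply]

/-- BASIS-FREE HEADLINE.  Let `f` be ANY linear endomorphism of the residual parameters `X → κ → ℝ` (functions on the
non-root vertices with values in the colour coordinates) which acts by the forest formula
`(f λ) x = C x · λ(parent x) − A x · λ(x)` (parent term `0` at a root), for a rank-decreasing rooted forest and unimodular
child-end matrices `A x`.  Then `|LinearMap.det f| = 1`.  (Conjugate by the curry isomorphism to `Matrix.toLin'` of the forest
matrix; `LinearMap.det_conj`, `LinearMap.det_toLin'`, §2.) [folklore] -/
theorem abs_linearMapDet_eq_one_of_forest_formula (f : Module.End ℝ (X → κ → ℝ)) (parent : X → Option X)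
    (C A : X → Matrix κ κ ℝ) (rk : X → ℕ) (hrk : ∀ x y, parent x = some y → rk y < rk x) (hA : ∀ x, |(A x).det| = 1)
    (hf : ∀ (lam : X → κ → ℝ) (x : X), f lam x = (parent x).elim 0 (fun y => C x *ᵥ lam y) - A x *ᵥ lam x) :
    |LinearMap.det f| = 1 := by
  let e : (X → κ → ℝ) ≃ₗ[ℝ] (X × κ → ℝ) := (LinearEquiv.curry ℝ ℝ X κ).symm
  have hconj : (e : (X → κ → ℝ) →ₗ[ℝ] (X × κ → ℝ)) ∘ₗ f ∘ₗ (e.symm : (X × κ → ℝ) →ₗ[ℝ] (X → κ → ℝ)) =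
      Matrix.toLin' (forestMatrix parent C A) := by
    apply LinearMap.ext
    intro v
    funext p
    rw [toLin'_forestMatrix_apply]
    simp only [e, LinearMap.coe_comp, LinearEquiv.coe_coe, Function.comp_apply, LinearEquiv.symm_symm,
      LinearEquiv.coe_curry, LinearEquiv.coe_curry_symm, Function.uncurry_def, hf]
  rw [← LinearMap.det_conj f e, hconj, LinearMap.det_toLin']
  exact abs_det_forestMatrix_eq_one parent C A rk hrk hA

/-- The same with orthogonal child-end matrices. [folklore] -/
theorem abs_linearMapDet_eq_one_of_forest_formula_orthogonal (f : Module.End ℝ (X → κ → ℝ)) (parent : X → Option X)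
    (C A : X → Matrix κ κ ℝ) (rk : X → ℕ) (hrk : ∀ x y, parent x = some y → rk y < rk x) (hA : ∀ x, (A x)ᵀ * A x = 1)
    (hf : ∀ (lam : X → κ → ℝ) (x : X), f lam x = (parent x).elim 0 (fun y => C x *ᵥ lam y) - A x *ᵥ lam x) :
    |LinearMap.det f| = 1 :=
  abs_linearMapDet_eq_one_of_forest_formula f parent C A rk hrk
    (fun x => abs_det_eq_one_of_transpose_mul_self_eq_one _ (hA x)) hf

/-- And `f` is then an automorphism-grade map: `LinearMap.det f ≠ 0` (hence `IsUnit`). [folklore] -/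
theorem isUnit_linearMapDet_of_forest_formula (f : Module.End ℝ (X → κ → ℝ)) (parent : X → Option X)
    (C A : X → Matrix κ κ ℝ) (rk : X → ℕ) (hrk : ∀ x y, parent x = some y → rk y < rk x) (hA : ∀ x, |(A x).det| = 1)
    (hf : ∀ (lam : X → κ → ℝ) (x : X), f lam x = (parent x).elim 0 (fun y => C x *ᵥ lam y) - A x *ᵥ lam x) :
    IsUnit (LinearMap.det f) := by
  rw [isUnit_iff_ne_zero]
  intro h
  have := abs_linearMapDet_eq_one_of_forest_formula f parent C A rk hrk hA hf
  rw [h, abs_zero] at this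
  exact zero_ne_one this

end BasisFree

/-! ## §6. (v1.1) ABSTRACT COLOUR FIBRE: the same for parameters valued in any finite-dimensional real vector space `V`
(e.g. the Lie algebra `𝔤` itself, transports `Ad(U_b(B)) : 𝔤 →ₗ 𝔤` with `|det| = 1`), no basis chosen by the consumer -/

section AbstractFibre

variable {X : Type*} [Fintype X] [DecidableEq X]
variable {V : Type*} [AddCommGroup V] [Module ℝ V] [FiniteDimensional ℝ V]

/-- BASIS-FREE HEADLINE, ABSTRACT FIBRE.  Let `f` be a linear endomorphism of `X → V` (`V` a finite-dimensional real vector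
space) acting by the forest formula `(f λ) x = Cx x (λ(parent x)) − Ax x (λ x)` (parent term `0` at a root) with `Cx x`
ARBITRARY and `|LinearMap.det (Ax x)| = 1` (e.g. `Ax x` an isometry / `Ad` of a compact group element), for a rank-decreasing
rooted forest.  Then `|LinearMap.det f| = 1`.  (Coordinates via `Module.finBasis`, then §5.) [folklore] -/
theorem abs_linearMapDet_eq_one_of_forest_formula' (f : Module.End ℝ (X → V)) (parent : X → Option X)
    (Cx Ax : X → Module.End ℝ V) (rk : X → ℕ) (hrk : ∀ x y, parent x = some y → rk y < rk x)
    (hA : ∀ x, |LinearMap.det (Ax x)| = 1)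
    (hf : ∀ (lam : X → V) (x : X), f lam x = (parent x).elim 0 (fun y => Cx x (lam y)) - Ax x (lam x)) :
    |LinearMap.det f| = 1 := by
  classical
  let b : Module.Basis (Fin (Module.finrank ℝ V)) ℝ V := Module.finBasis ℝ V
  let eV : V ≃ₗ[ℝ] (Fin (Module.finrank ℝ V) → ℝ) := b.equivFun
  let e : (X → V) ≃ₗ[ℝ] (X → Fin (Module.finrank ℝ V) → ℝ) := LinearEquiv.piCongrRight fun _ => eV
  have hrepr : ∀ w : V, (eV w : Fin (Module.finrank ℝ V) → ℝ) = ⇑(b.repr w) := by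
    intro w; exact b.equivFun_apply w
  rw [← LinearMap.det_conj f e]
  refine abs_linearMapDet_eq_one_of_forest_formula _ parent (fun x => LinearMap.toMatrix b b (Cx x))
    (fun x => LinearMap.toMatrix b b (Ax x)) rk hrk (fun x => by rw [LinearMap.det_toMatrix]; exact hA x) ?_
  intro lam x
  have h1 : ((e : (X → V) →ₗ[ℝ] (X → Fin (Module.finrank ℝ V) → ℝ)) ∘ₗ f ∘ₗ
      (e.symm : (X → Fin (Module.finrank ℝ V) → ℝ) →ₗ[ℝ] (X → V))) lam x = eV (f (fun y => eV.symm (lam y)) x) := rfl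
  rw [h1, hf, map_sub]
  congr 1
  · cases parent x with
    | none => simp
    | some y =>
      simp only [Option.elim]
      rw [hrepr, ← LinearMap.toMatrix_mulVec_repr b b (Cx x) (eV.symm (lam y)), ← hrepr (eV.symm (lam y)),
        LinearEquiv.apply_symm_apply]
  · rw [hrepr, ← LinearMap.toMatrix_mulVec_repr b b (Ax x) (eV.symm (lam x)), ← hrepr (eV.symm (lam x)),
      LinearEquiv.apply_symm_apply]

end AbstractFibre

/-! ## §7. (v1.2) THE IDENT-122 (D-e) CLAUSE FOR A FOREST SLICE: the Faddeev–Popov logarithm of a forest slice is IDENTICALLY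
ZERO, hence so is its Hessian at `0` — «for τ = τ_tree the second term of (D-e) is 0 by the unipotency lemma» as a kernel statement -/

section FPLogZero

variable {X κ : Type*} [Fintype X] [DecidableEq X] [Fintype κ] [DecidableEq κ]
variable {𝓑 : Type*} {r n : ℕ}

/-- For a forest slice the Faddeev–Popov LOGARITHM vanishes identically: `log |det (P B * W B)| = 0` for every `B`. [folklore] -/
theorem log_abs_det_eq_zero_of_forest (P : 𝓑 → Matrix (Fin r) (Fin n) ℝ) (W : 𝓑 → Matrix (Fin n) (Fin r) ℝ)
    (e : X × κ ≃ Fin r) (parent : X → Option X) (rk : X → ℕ) (hrk : ∀ x y, parent x = some y → rk y < rk x)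
    (C A : 𝓑 → X → Matrix κ κ ℝ) (hA : ∀ B x, |(A B x).det| = 1)
    (hPW : ∀ B, P B * W B = Matrix.reindex e e (forestMatrix parent (C B) (A B))) (B : 𝓑) :
    Real.log |(P B * W B).det| = 0 := by
  rw [abs_det_eq_one_of_eq_reindex_forestMatrix _ e parent (C B) (A B) rk hrk (hA B) (hPW B), Real.log_one]

/-- As a function of the background the Faddeev–Popov logarithm of a forest slice IS the zero function. [folklore] -/
theorem log_abs_det_forest_eq_zero_fun (P : 𝓑 → Matrix (Fin r) (Fin n) ℝ) (W : 𝓑 → Matrix (Fin n) (Fin r) ℝ)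
    (e : X × κ ≃ Fin r) (parent : X → Option X) (rk : X → ℕ) (hrk : ∀ x y, parent x = some y → rk y < rk x)
    (C A : 𝓑 → X → Matrix κ κ ℝ) (hA : ∀ B x, |(A B x).det| = 1)
    (hPW : ∀ B, P B * W B = Matrix.reindex e e (forestMatrix parent (C B) (A B))) :
    (fun B => Real.log |(P B * W B).det|) = fun _ => 0 :=
  funext fun B => log_abs_det_eq_zero_of_forest P W e parent rk hrk C A hA hPW B

variable {ι : Type*} [Fintype ι] [DecidableEq ι]

/-- The cell's `hessianAt` (= `iteratedFDeriv ℝ 2 · 0` on two coordinate vectors, `Beta.OneLoop`) of a CONSTANT function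
vanishes. [folklore] -/
theorem hessianAt_const (c : ℝ) (i j : ι) : hessianAt (fun _ : ι → ℝ => c) i j = 0 := by
  unfold hessianAt
  rw [iteratedFDeriv_const_of_ne (by norm_num) c]
  rfl

/-- IDENT-122 (D-e) FOR A FOREST SLICE.  The «second term» `Hess₀ log|det(τ·W)|` of the orbit one-loop Hessian vanishes
ENTRYWISE when the named slice `τ` is a forest slice (block tree / axial): `hessianAt (B ↦ log|det(P B * W B)|) i j = 0`. [folklore] -/
theorem hessianAt_log_abs_det_eq_zero_of_forest (P : (ι → ℝ) → Matrix (Fin r) (Fin n) ℝ)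
    (W : (ι → ℝ) → Matrix (Fin n) (Fin r) ℝ) (e : X × κ ≃ Fin r) (parent : X → Option X) (rk : X → ℕ)
    (hrk : ∀ x y, parent x = some y → rk y < rk x) (C A : (ι → ℝ) → X → Matrix κ κ ℝ) (hA : ∀ B x, |(A B x).det| = 1)
    (hPW : ∀ B, P B * W B = Matrix.reindex e e (forestMatrix parent (C B) (A B))) (i j : ι) :
    hessianAt (fun B => Real.log |(P B * W B).det|) i j = 0 := by
  rw [log_abs_det_forest_eq_zero_fun P W e parent rk hrk C A hA hPW]
  exact hessianAt_const 0 i j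

omit [DecidableEq ι] in
/-- And the Faddeev–Popov logarithm of a forest slice is (trivially) smooth at `0` — the `ContDiffAt ℝ 2` hypothesis that the
sibling's defect theorems II′ ask of it. [folklore] -/
theorem contDiffAt_log_abs_det_of_forest (P : (ι → ℝ) → Matrix (Fin r) (Fin n) ℝ)
    (W : (ι → ℝ) → Matrix (Fin n) (Fin r) ℝ) (e : X × κ ≃ Fin r) (parent : X → Option X) (rk : X → ℕ)
    (hrk : ∀ x y, parent x = some y → rk y < rk x) (C A : (ι → ℝ) → X → Matrix κ κ ℝ) (hA : ∀ B x, |(A B x).det| = 1)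
    (hPW : ∀ B, P B * W B = Matrix.reindex e e (forestMatrix parent (C B) (A B))) {m : WithTop ℕ∞} :
    ContDiffAt ℝ m (fun B => Real.log |(P B * W B).det|) 0 := by
  rw [log_abs_det_forest_eq_zero_fun P W e parent rk hrk C A hA hPW]
  exact contDiffAt_const

end FPLogZero

/-! ## §8. (v1.2) NESTED FORESTS COMPOSE TO A FOREST («nested block trees compose to a block tree»): the combined parent map of a
fine forest whose roots are the vertices of a coarse forest is again rank-decreasing — so the COMPOSED slice (fine tree rows inside
the small blocks + coarse tree rows on the block centres) is unipotent by the SAME headline, and the inter-slice Faddeev–Popov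
quotient between nested tree slices is `log 1 − log 1 = 0` (pure combinatorics; which cell rows have this shape is theirs to state) -/

section Compose

variable {X₁ X₂ : Type*}

/-- COMBINED PARENT of a two-level forest.  Fine vertices `X₁` with fine parent `p₁` (`none` = the fine parent is the ROOT of the
fine tree, i.e. the block centre `ctr x`: `some y` = a coarse vertex, `none` = a top root); coarse vertices `X₂` with coarse parent
`p₂` (`none` = a top root). [folklore] -/
def composeParent (p₁ : X₁ → Option X₁) (ctr : X₁ → Option X₂) (p₂ : X₂ → Option X₂) : X₁ ⊕ X₂ → Option (X₁ ⊕ X₂)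
  | Sum.inl x => (p₁ x).elim ((ctr x).map Sum.inr) fun x' => some (Sum.inl x')
  | Sum.inr y => (p₂ y).map Sum.inr

/-- COMBINED RANK: a coarse vertex of coarse depth `c` gets `c + 1`; a fine vertex gets (rank of its centre, `0` for a top root)
`+` its fine depth. [folklore] -/
def composeRank (rk₁ : X₁ → ℕ) (ctr : X₁ → Option X₂) (rk₂ : X₂ → ℕ) : X₁ ⊕ X₂ → ℕ
  | Sum.inl x => ((ctr x).elim 0 fun y => rk₂ y + 1) + rk₁ x
  | Sum.inr y => rk₂ y + 1

/-- The combined parent map is RANK-DECREASING provided: the fine parent lowers the fine rank and keeps the centre, every fine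
vertex has POSITIVE fine rank (it is not its own centre), and the coarse parent lowers the coarse rank. [folklore] -/
theorem composeParent_rank_lt (p₁ : X₁ → Option X₁) (ctr : X₁ → Option X₂) (p₂ : X₂ → Option X₂)
    (rk₁ : X₁ → ℕ) (rk₂ : X₂ → ℕ)
    (h₁ : ∀ x x', p₁ x = some x' → rk₁ x' < rk₁ x) (hctr : ∀ x x', p₁ x = some x' → ctr x' = ctr x)
    (hpos : ∀ x, 0 < rk₁ x) (h₂ : ∀ y y', p₂ y = some y' → rk₂ y' < rk₂ y) :
    ∀ v w, composeParent p₁ ctr p₂ v = some w →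
      composeRank rk₁ ctr rk₂ w < composeRank rk₁ ctr rk₂ v := by
  rintro (x | y) w hw
  · -- fine vertex
    simp only [composeParent] at hw
    cases hp : p₁ x with
    | some x' =>
      rw [hp] at hw
      simp only [Option.elim] at hw
      cases hw
      simp only [composeRank, hctr x x' hp]
      have := h₁ x x' hp
      omega
    | none =>
      rw [hp] at hw
      simp only [Option.elim] at hw
      cases hc : ctr x with
      | none => rw [hc] at hw; simp at hw
      | some y =>
        rw [hc] at hw
        simp only [Option.map_some, Option.some.injEq] at hw
        subst hw
        simp only [composeRank, hc, Option.elim]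
        have := hpos x
        omega
  · -- coarse vertex
    simp only [composeParent] at hw
    cases hp : p₂ y with
    | none => rw [hp] at hw; simp at hw
    | some y' =>
      rw [hp] at hw
      simp only [Option.map_some, Option.some.injEq] at hw
      subst hw
      simp only [composeRank]
      have := h₂ y y' hp
      omega

variable [Fintype X₁] [DecidableEq X₁] [Fintype X₂] [DecidableEq X₂]
variable {κ : Type*} [Fintype κ] [DecidableEq κ]

/-- NESTED FORESTS: the forest matrix of the COMBINED two-level forest (fine trees rooted at the coarse vertices, coarse forest on
those) with unimodular child-end blocks is unimodular — the composed slice ∘ orbit map has `|det| = 1` for every background, by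
the v1 headline applied to `composeParent`/`composeRank`. [folklore] -/
theorem abs_det_forestMatrix_compose_eq_one (p₁ : X₁ → Option X₁) (ctr : X₁ → Option X₂) (p₂ : X₂ → Option X₂)
    (rk₁ : X₁ → ℕ) (rk₂ : X₂ → ℕ)
    (h₁ : ∀ x x', p₁ x = some x' → rk₁ x' < rk₁ x) (hctr : ∀ x x', p₁ x = some x' → ctr x' = ctr x)
    (hpos : ∀ x, 0 < rk₁ x) (h₂ : ∀ y y', p₂ y = some y' → rk₂ y' < rk₂ y)
    (C A : X₁ ⊕ X₂ → Matrix κ κ ℝ) (hA : ∀ v, |(A v).det| = 1) :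
    |(forestMatrix (composeParent p₁ ctr p₂) C A).det| = 1 :=
  abs_det_forestMatrix_eq_one _ C A (composeRank rk₁ ctr rk₂)
    (composeParent_rank_lt p₁ ctr p₂ rk₁ rk₂ h₁ hctr hpos h₂) hA

end Compose

/-! ## §9. (v1.3) BAŁABAN'S COMB (AXIAL-CONTOUR) FOREST ON ONE BLOCK, as concrete `parent`/`rk` data: non-zero offsets
`v : Fin d → Fin L` from the block base point (`L ≥ 1` the block side); the parent of `v` lowers by one the LOWEST-INDEX non-zero
coordinate — the predecessor of the site on the axial contour `Γ_{y,x}` of [B5-I] (1.7) as typed by an1 (`AveragingContours.axial`: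
«first the segment moving `x_d`, last the one moving `x₁`», so the last bond of `Γ_{y,x}` moves the lowest-index coordinate in which `x`
differs from `y`); the rank is the `ℓ¹` length `Σ_i v_i = |Γ_{y,x}|` (an1 `axial_length`).  Pure combinatorics; that a row's per-block
map has the forest formula for THIS parent map is that row's CHECK ITEM (D-h). -/

section Comb

variable {d L : ℕ} [NeZero L]

/-- The non-root vertices of the comb tree of one block: non-zero offsets from the base point. [folklore] -/
abbrev CombVertex (d L : ℕ) [NeZero L] : Type := {v : Fin d → Fin L // v ≠ 0}

/-- The set of coordinates in which an offset is non-zero. [folklore] -/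
def nzCoords (v : Fin d → Fin L) : Finset (Fin d) := Finset.univ.filter fun i => (v i : ℕ) ≠ 0

/-- A non-root vertex has a non-zero coordinate. [folklore] -/
theorem nzCoords_nonempty (x : CombVertex d L) : (nzCoords x.1).Nonempty := by
  by_contra h
  rw [Finset.not_nonempty_iff_eq_empty] at h
  apply x.2
  funext i
  have hi : i ∉ nzCoords x.1 := by rw [h]; exact Finset.notMem_empty i
  simp only [nzCoords, Finset.mem_filter, Finset.mem_univ, true_and, not_not] at hi
  exact Fin.ext (by rw [hi]; simp)

/-- The lowest-index non-zero coordinate of a comb vertex (the direction of the LAST bond of its axial contour). [folklore] -/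
def lowIdx (x : CombVertex d L) : Fin d := (nzCoords x.1).min' (nzCoords_nonempty x)

/-- `lowIdx x` is a non-zero coordinate. [folklore] -/
theorem lowIdx_mem (x : CombVertex d L) : lowIdx x ∈ nzCoords x.1 := Finset.min'_mem _ _

/-- The lowest non-zero coordinate is non-zero. [folklore] -/
theorem val_lowIdx_ne_zero (x : CombVertex d L) : (x.1 (lowIdx x) : ℕ) ≠ 0 := by
  have h := lowIdx_mem x
  simp only [nzCoords, Finset.mem_filter, Finset.mem_univ, true_and] at h
  exact h

/-- The predecessor offset: lower the lowest-index non-zero coordinate by one. [folklore] -/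
def combPred (x : CombVertex d L) : Fin d → Fin L :=
  Function.update x.1 (lowIdx x) ⟨(x.1 (lowIdx x) : ℕ) - 1, by have h := (x.1 (lowIdx x)).isLt; omega⟩

/-- Coordinates of the predecessor offset. [folklore] -/
theorem combPred_apply_val (x : CombVertex d L) (i : Fin d) :
    (combPred x i : ℕ) = if i = lowIdx x then (x.1 (lowIdx x) : ℕ) - 1 else (x.1 i : ℕ) := by
  unfold combPred
  by_cases hi : i = lowIdx x
  · subst hi; simp
  · simp [hi]

/-- THE COMB PARENT MAP: `none` when the predecessor is the base point itself. [folklore] -/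
def combParent (x : CombVertex d L) : Option (CombVertex d L) :=
  if h : combPred x = 0 then none else some ⟨combPred x, h⟩

/-- THE COMB RANK: the `ℓ¹` length of the offset = the number of bonds of the axial contour. [folklore] -/
def combRank (x : CombVertex d L) : ℕ := ∑ i, (x.1 i : ℕ)

/-- The comb rank of a non-root vertex is positive. [folklore] -/
theorem combRank_pos (x : CombVertex d L) : 0 < combRank x := by
  unfold combRank
  exact lt_of_lt_of_le (Nat.pos_of_ne_zero (val_lowIdx_ne_zero x))
    (Finset.single_le_sum (f := fun i => (x.1 i : ℕ)) (fun i _ => Nat.zero_le _) (Finset.mem_univ (lowIdx x)))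

/-- The rank of the predecessor offset is one less. [folklore] -/
theorem sum_combPred (x : CombVertex d L) : (∑ i, (combPred x i : ℕ)) + 1 = combRank x := by
  unfold combRank
  have hmem : lowIdx x ∈ (Finset.univ : Finset (Fin d)) := Finset.mem_univ _
  rw [← Finset.add_sum_erase _ _ hmem, ← Finset.add_sum_erase _ (fun i => (x.1 i : ℕ)) hmem]
  have hrest : ∑ i ∈ Finset.univ.erase (lowIdx x), (combPred x i : ℕ) = ∑ i ∈ Finset.univ.erase (lowIdx x), (x.1 i : ℕ) := by
    refine Finset.sum_congr rfl fun i hi => ?_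
    rw [combPred_apply_val, if_neg (Finset.ne_of_mem_erase hi)]
  rw [hrest, combPred_apply_val, if_pos rfl]
  have := val_lowIdx_ne_zero x
  omega

/-- THE COMB FOREST IS RANK-DECREASING. [folklore] -/
theorem combParent_rank_lt (x y : CombVertex d L) (h : combParent x = some y) : combRank y < combRank x := by
  unfold combParent at h
  by_cases h0 : combPred x = 0
  · rw [dif_pos h0] at h; exact absurd h (by simp)
  · rw [dif_neg h0] at h
    simp only [Option.some.injEq] at h
    subst h
    have := sum_combPred x
    show (∑ i, (combPred x i : ℕ)) < ∑ i, (x.1 i : ℕ)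
    unfold combRank at this
    omega

variable {κ : Type*} [Fintype κ] [DecidableEq κ]

/-- PER-BLOCK UNIPOTENCY FOR BAŁABAN'S COMB TREE: the forest matrix of the comb forest of one block (any dimension `d`, any
side `L ≥ 1`), with ARBITRARY parent-end blocks and unimodular child-end blocks (e.g. `∓R(U_{b_x}(B))`), has `|det| = 1`. [folklore] -/
theorem abs_det_forestMatrix_comb_eq_one (C A : CombVertex d L → Matrix κ κ ℝ) (hA : ∀ x, |(A x).det| = 1) :
    |(forestMatrix (combParent (d := d) (L := L)) C A).det| = 1 :=
  abs_det_forestMatrix_eq_one _ C A combRank (fun x y h => combParent_rank_lt x y h) hA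

/-- And the letter-level form: any endomorphism of `CombVertex d L → V` acting by the comb-forest formula is unimodular. [folklore] -/
theorem abs_linearMapDet_eq_one_of_comb_formula {V : Type*} [AddCommGroup V] [Module ℝ V] [FiniteDimensional ℝ V]
    (f : Module.End ℝ (CombVertex d L → V)) (Cx Ax : CombVertex d L → Module.End ℝ V)
    (hA : ∀ x, |LinearMap.det (Ax x)| = 1)
    (hf : ∀ (lam : CombVertex d L → V) (x : CombVertex d L),
      f lam x = (combParent x).elim 0 (fun y => Cx x (lam y)) - Ax x (lam x)) :
    |LinearMap.det f| = 1 :=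
  abs_linearMapDet_eq_one_of_forest_formula' f combParent Cx Ax combRank (fun x y h => combParent_rank_lt x y h) hA hf

end Comb

/-! ## §10. (v1.4) HIERARCHY — the combinatorial skeleton of route (α) item (A4) («hierarchical `Π`: `Π_{L^{m+1}}` versus
`Π_{L^m}`», RULING (R29-4); BETA-SPEC §7.48 (c) (SDF-α) «composed tree slices are unipotent»): (a) the `hpos`-free compose
headline (rank shift `rk₁ + 1`; closes XREAD C-pv10-103 INFO I1); (b) REPLICATED fine forests over the CELLS of a coarse forest —
ANY rank-decreasing fine forest copied into every cell, the roots of the cell of the coarse vertex `c` attached to `c`, the roots of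
the root cell attached to the top root (`replicateParent`, `cellCtr`, `hierParent`, `hierRank`, `hierParent_rank_lt`,
`abs_det_forestMatrix_hier_eq_one`, `abs_linearMapDet_eq_one_of_hier_formula`) = EXACTLY the inductive step «level `m` → level
`m+1`» of the block hierarchy, with no side condition beyond the two rank decreases; (c) the `m`-LEVEL COMB TOWER by recursion
(`TowerVertex d L m`, `towerParent`, `towerRank`, `towerParent_rank_lt`, `card_towerVertex_succ : #vertices + 1 = L^{d(m+1)}`,
`abs_det_forestMatrix_tower_eq_one`, `abs_linearMapDet_eq_one_of_tower_formula`): the composed block-tree slice of `m+1` successive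
axial gauge fixings, seen on the original lattice inside one `L^{m+1}`-block, is unipotent for every `d`, `L ≥ 1`, `m`, with
ARBITRARY parent-end transports and unimodular child-end transports.  Pure combinatorics over §2/§6/§8/§9; which cell row's
per-block map has this shape (and with which transports) is that row's CHECK ITEM (D-h); nothing of the series is asserted. -/

section HierarchyShift

variable {X₁ X₂ : Type*}

/-- (v1.4; closes XREAD C-pv10-103 INFO I1) The compose rank-decrease WITHOUT the positivity side condition `hpos` of
`composeParent_rank_lt`: shift the fine rank by one (`rk₁ + 1`), so that a fine root of positive combined rank sits strictly above
its centre. [folklore] -/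
theorem composeParent_rank_lt_shift (p₁ : X₁ → Option X₁) (ctr : X₁ → Option X₂) (p₂ : X₂ → Option X₂)
    (rk₁ : X₁ → ℕ) (rk₂ : X₂ → ℕ)
    (h₁ : ∀ x x', p₁ x = some x' → rk₁ x' < rk₁ x) (hctr : ∀ x x', p₁ x = some x' → ctr x' = ctr x)
    (h₂ : ∀ y y', p₂ y = some y' → rk₂ y' < rk₂ y) :
    ∀ v w, composeParent p₁ ctr p₂ v = some w →
      composeRank (fun x => rk₁ x + 1) ctr rk₂ w < composeRank (fun x => rk₁ x + 1) ctr rk₂ v :=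
  composeParent_rank_lt p₁ ctr p₂ (fun x => rk₁ x + 1) rk₂ (fun x x' h => Nat.succ_lt_succ (h₁ x x' h)) hctr
    (fun _ => Nat.succ_pos _) h₂

variable [Fintype X₁] [DecidableEq X₁] [Fintype X₂] [DecidableEq X₂]
variable {κ : Type*} [Fintype κ] [DecidableEq κ]

/-- (v1.4) NESTED FORESTS, `hpos`-FREE: the forest matrix of the combined two-level forest with unimodular child-end blocks is
unimodular, assuming only the two rank-decrease hypotheses and the centre-compatibility `hctr`. [folklore] -/
theorem abs_det_forestMatrix_compose_eq_one' (p₁ : X₁ → Option X₁) (ctr : X₁ → Option X₂) (p₂ : X₂ → Option X₂)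
    (rk₁ : X₁ → ℕ) (rk₂ : X₂ → ℕ)
    (h₁ : ∀ x x', p₁ x = some x' → rk₁ x' < rk₁ x) (hctr : ∀ x x', p₁ x = some x' → ctr x' = ctr x)
    (h₂ : ∀ y y', p₂ y = some y' → rk₂ y' < rk₂ y)
    (C A : X₁ ⊕ X₂ → Matrix κ κ ℝ) (hA : ∀ v, |(A v).det| = 1) :
    |(forestMatrix (composeParent p₁ ctr p₂) C A).det| = 1 :=
  abs_det_forestMatrix_eq_one _ C A (composeRank (fun x => rk₁ x + 1) ctr rk₂)
    (composeParent_rank_lt_shift p₁ ctr p₂ rk₁ rk₂ h₁ hctr h₂) hA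

end HierarchyShift

section Replicate

variable {Y X₂ : Type*}

/-- (v1.4) REPLICATED FINE FOREST over the coarse CELLS `Option X₂` (`some c` = the cell whose centre is the coarse vertex `c`;
`none` = the ROOT CELL, the cell whose centre is the top root): the SAME fine forest `p` inside every cell. [folklore] -/
def replicateParent (p : Y → Option Y) : Option X₂ × Y → Option (Option X₂ × Y) :=
  fun v => (p v.2).map fun y' => (v.1, y')

/-- (v1.4) The centre of a replicated fine vertex is its cell label. [folklore] -/
def cellCtr : Option X₂ × Y → Option X₂ := Prod.fst

/-- (v1.4) THE HIERARCHICAL (two-level) PARENT MAP: replicated fine forests inside the cells, the roots of cell `some c` attached to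
the coarse vertex `c`, the roots of the root cell attached to the top root, and the coarse forest `p₂` on the cell centres. [folklore] -/
def hierParent (p : Y → Option Y) (p₂ : X₂ → Option X₂) : (Option X₂ × Y) ⊕ X₂ → Option ((Option X₂ × Y) ⊕ X₂) :=
  composeParent (replicateParent p) cellCtr p₂

/-- (v1.4) THE HIERARCHICAL RANK (fine rank shifted by one, on top of the centre's rank). [folklore] -/
def hierRank (rk : Y → ℕ) (rk₂ : X₂ → ℕ) : (Option X₂ × Y) ⊕ X₂ → ℕ :=
  composeRank (fun v : Option X₂ × Y => rk v.2 + 1) cellCtr rk₂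

/-- (v1.4) The replicated parent of `v` is `w` iff `w` lies in the same cell and is the fine parent there. [folklore] -/
theorem replicateParent_eq_some_iff (p : Y → Option Y) (v w : Option X₂ × Y) :
    replicateParent p v = some w ↔ w.1 = v.1 ∧ p v.2 = some w.2 := by
  unfold replicateParent
  constructor
  · intro h
    cases hp : p v.2 with
    | none => rw [hp] at h; simp at h
    | some y' =>
      rw [hp, Option.map_some, Option.some.injEq] at h
      subst h; exact ⟨rfl, rfl⟩
  · rintro ⟨h1, h2⟩
    rw [h2, Option.map_some]
    cases w; cases v; simp only at h1; subst h1; rfl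

/-- (v1.4) Shape, fine vertex with a fine parent: the parent is the same vertex of the SAME cell. [folklore] -/
theorem hierParent_inl_of_some (p : Y → Option Y) (p₂ : X₂ → Option X₂) (c : Option X₂) {y y' : Y} (h : p y = some y') :
    hierParent p p₂ (Sum.inl (c, y)) = some (Sum.inl (c, y')) := by
  simp [hierParent, composeParent, replicateParent, h]

/-- (v1.4) Shape, fine root of the cell of the coarse vertex `c`: its parent is `c`. [folklore] -/
theorem hierParent_inl_of_none_some (p : Y → Option Y) (p₂ : X₂ → Option X₂) (c : X₂) {y : Y} (h : p y = none) :
    hierParent p p₂ (Sum.inl (some c, y)) = some (Sum.inr c) := by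
  simp [hierParent, composeParent, replicateParent, cellCtr, h]

/-- (v1.4) Shape, fine root of the root cell: its parent is the top root. [folklore] -/
theorem hierParent_inl_of_none_none (p : Y → Option Y) (p₂ : X₂ → Option X₂) {y : Y} (h : p y = none) :
    hierParent p p₂ (Sum.inl (none, y)) = none := by
  simp [hierParent, composeParent, replicateParent, cellCtr, h]

/-- (v1.4) Shape, coarse vertex: its parent is its coarse parent. [folklore] -/
theorem hierParent_inr (p : Y → Option Y) (p₂ : X₂ → Option X₂) (c : X₂) :
    hierParent p p₂ (Sum.inr c) = (p₂ c).map Sum.inr := rfl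

/-- (v1.4) THE HIERARCHICAL FOREST IS RANK-DECREASING, for ANY rank-decreasing fine forest and ANY rank-decreasing coarse
forest (no positivity side condition). [folklore] -/
theorem hierParent_rank_lt (p : Y → Option Y) (p₂ : X₂ → Option X₂) (rk : Y → ℕ) (rk₂ : X₂ → ℕ)
    (hp : ∀ y y', p y = some y' → rk y' < rk y) (h₂ : ∀ c c', p₂ c = some c' → rk₂ c' < rk₂ c) :
    ∀ v w, hierParent p p₂ v = some w → hierRank rk rk₂ w < hierRank rk rk₂ v :=
  composeParent_rank_lt_shift (replicateParent p) cellCtr p₂ (fun v => rk v.2) rk₂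
    (fun v w h => by
      rw [replicateParent_eq_some_iff] at h
      exact hp _ _ h.2)
    (fun v w h => by
      rw [replicateParent_eq_some_iff] at h
      exact h.1)
    h₂

variable [Fintype Y] [DecidableEq Y] [Fintype X₂] [DecidableEq X₂]
variable {κ : Type*} [Fintype κ] [DecidableEq κ]

/-- (v1.4) HIERARCHICAL UNIPOTENCY (the inductive step «level `m` → level `m+1`» of the block hierarchy): the forest matrix of
the hierarchical forest — ANY unimodular-forest-matrix-bearing fine forest replicated in the cells of ANY rank-decreasing coarse
forest — with ARBITRARY parent-end blocks and unimodular child-end blocks has `|det| = 1`. [folklore] -/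
theorem abs_det_forestMatrix_hier_eq_one (p : Y → Option Y) (p₂ : X₂ → Option X₂) (rk : Y → ℕ) (rk₂ : X₂ → ℕ)
    (hp : ∀ y y', p y = some y' → rk y' < rk y) (h₂ : ∀ c c', p₂ c = some c' → rk₂ c' < rk₂ c)
    (C A : (Option X₂ × Y) ⊕ X₂ → Matrix κ κ ℝ) (hA : ∀ v, |(A v).det| = 1) :
    |(forestMatrix (hierParent p p₂) C A).det| = 1 :=
  abs_det_forestMatrix_eq_one _ C A (hierRank rk rk₂) (hierParent_rank_lt p p₂ rk rk₂ hp h₂) hA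

/-- (v1.4) The letter-level form over an abstract finite-dimensional fibre. [folklore] -/
theorem abs_linearMapDet_eq_one_of_hier_formula {V : Type*} [AddCommGroup V] [Module ℝ V] [FiniteDimensional ℝ V]
    (p : Y → Option Y) (p₂ : X₂ → Option X₂) (rk : Y → ℕ) (rk₂ : X₂ → ℕ)
    (hp : ∀ y y', p y = some y' → rk y' < rk y) (h₂ : ∀ c c', p₂ c = some c' → rk₂ c' < rk₂ c)
    (f : Module.End ℝ ((Option X₂ × Y) ⊕ X₂ → V)) (Cx Ax : (Option X₂ × Y) ⊕ X₂ → Module.End ℝ V)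
    (hA : ∀ v, |LinearMap.det (Ax v)| = 1)
    (hf : ∀ (lam : (Option X₂ × Y) ⊕ X₂ → V) (v : (Option X₂ × Y) ⊕ X₂),
      f lam v = (hierParent p p₂ v).elim 0 (fun w => Cx v (lam w)) - Ax v (lam v)) :
    |LinearMap.det f| = 1 :=
  abs_linearMapDet_eq_one_of_forest_formula' f (hierParent p p₂) Cx Ax (hierRank rk rk₂)
    (hierParent_rank_lt p p₂ rk rk₂ hp h₂) hA hf

end Replicate

section Tower

variable {d L : ℕ} [NeZero L]

/-- (v1.4) THE VERTEX TYPE OF THE `m`-LEVEL COMB TOWER: level `0` = the comb of one `L`-block; level `m+1` = the comb tower of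
level `m` replicated in the `L^d` cells (cells labelled by `Option (CombVertex d L)`, `none` = the cell at the base corner) plus
the coarse comb on the cell base points. [folklore] -/
def TowerVertex (d L : ℕ) [NeZero L] : ℕ → Type
  | 0 => CombVertex d L
  | m + 1 => (Option (CombVertex d L) × TowerVertex d L m) ⊕ CombVertex d L

/-- (v1.4) The tower vertex types are finite (by recursion on the level). [folklore] -/
instance instFintypeTowerVertex : ∀ m, Fintype (TowerVertex d L m)
  | 0 => inferInstanceAs (Fintype (CombVertex d L))
  | m + 1 =>
    haveI : Fintype (TowerVertex d L m) := instFintypeTowerVertex m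
    inferInstanceAs (Fintype ((Option (CombVertex d L) × TowerVertex d L m) ⊕ CombVertex d L))

/-- (v1.4) The tower vertex types have decidable equality (by recursion on the level). [folklore] -/
instance instDecidableEqTowerVertex : ∀ m, DecidableEq (TowerVertex d L m)
  | 0 => inferInstanceAs (DecidableEq (CombVertex d L))
  | m + 1 =>
    haveI : DecidableEq (TowerVertex d L m) := instDecidableEqTowerVertex m
    inferInstanceAs (DecidableEq ((Option (CombVertex d L) × TowerVertex d L m) ⊕ CombVertex d L))

/-- (v1.4) THE TOWER PARENT MAP, by recursion on the level. [folklore] -/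
def towerParent : ∀ m, TowerVertex d L m → Option (TowerVertex d L m)
  | 0 => combParent
  | m + 1 => hierParent (towerParent m) combParent

/-- (v1.4) THE TOWER RANK, by recursion on the level. [folklore] -/
def towerRank : ∀ m, TowerVertex d L m → ℕ
  | 0 => combRank
  | m + 1 => hierRank (towerRank m) combRank

/-- (v1.4) Level `0` of the tower is the comb of one block. [folklore] -/
theorem towerParent_zero : towerParent (d := d) (L := L) 0 = combParent := rfl

/-- (v1.4) Level `m+1` of the tower is the hierarchical forest of level `m` over the coarse comb. [folklore] -/
theorem towerParent_succ (m : ℕ) :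
    towerParent (d := d) (L := L) (m + 1) = hierParent (towerParent m) combParent := rfl

/-- (v1.4) Level `0` rank = the comb rank. [folklore] -/
theorem towerRank_zero : towerRank (d := d) (L := L) 0 = combRank := rfl

/-- (v1.4) Level `m+1` rank = the hierarchical rank of level `m` over the comb rank. [folklore] -/
theorem towerRank_succ (m : ℕ) : towerRank (d := d) (L := L) (m + 1) = hierRank (towerRank m) combRank := rfl

/-- (v1.4) In particular the TWO-LEVEL comb (fine combs in the `L^d` cells of an `L²`-block + the coarse comb on the cell base
points) is level `1`. [folklore] -/
theorem towerParent_one : towerParent (d := d) (L := L) 1 = hierParent combParent combParent := rfl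

/-- (v1.4) THE COMB TOWER IS RANK-DECREASING at every level. [folklore] -/
theorem towerParent_rank_lt : ∀ (m : ℕ) (v w : TowerVertex d L m),
    towerParent m v = some w → towerRank m w < towerRank m v
  | 0 => fun v w h => combParent_rank_lt v w h
  | m + 1 => hierParent_rank_lt (towerParent m) combParent (towerRank m) combRank
      (towerParent_rank_lt m) (fun x y h => combParent_rank_lt x y h)

/-- (v1.4) One `L`-block has `L^d − 1` non-root vertices. [folklore] -/
theorem card_combVertex_succ : Fintype.card (CombVertex d L) + 1 = L ^ d := by
  classical
  have h : Fintype.card (CombVertex d L) =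
      Fintype.card (Fin d → Fin L) - Fintype.card {v : Fin d → Fin L // v = 0} :=
    Fintype.card_subtype_compl _
  rw [Fintype.card_subtype_eq, Fintype.card_pi] at h
  simp only [Fintype.card_fin, Finset.prod_const, Finset.card_univ] at h
  have : 1 ≤ L ^ d := Nat.one_le_pow _ _ (Nat.pos_of_ne_zero (NeZero.ne L))
  omega

/-- (v1.4) The `m`-level tower covers every site of the `L^{m+1}`-block except its base point: `#vertices + 1 = L^{d(m+1)}`.
[folklore] -/
theorem card_towerVertex_succ : ∀ m, Fintype.card (TowerVertex d L m) + 1 = L ^ (d * (m + 1))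
  | 0 => by
    show Fintype.card (CombVertex d L) + 1 = _
    rw [show d * (0 + 1) = d by ring]
    exact card_combVertex_succ
  | m + 1 => by
    show Fintype.card ((Option (CombVertex d L) × TowerVertex d L m) ⊕ CombVertex d L) + 1 = _
    have ih := card_towerVertex_succ m
    have h0 : Fintype.card (CombVertex d L) + 1 = L ^ d := card_combVertex_succ
    rw [Fintype.card_sum, Fintype.card_prod, Fintype.card_option]
    have hL : L ^ (d * (m + 1 + 1)) = L ^ d * L ^ (d * (m + 1)) := by ring
    rw [hL, ← ih, ← h0]
    ring

variable {κ : Type*} [Fintype κ] [DecidableEq κ]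

/-- (v1.4) UNIPOTENCY OF THE `m`-LEVEL COMB TOWER (the composed block-tree slice of `m+1` hierarchical axial gauge fixings, at
matrix level): ARBITRARY parent-end blocks, unimodular child-end blocks ⇒ `|det| = 1`, every `d`, `L ≥ 1`, `m`. [folklore] -/
theorem abs_det_forestMatrix_tower_eq_one (m : ℕ) (C A : TowerVertex d L m → Matrix κ κ ℝ) (hA : ∀ v, |(A v).det| = 1) :
    |(forestMatrix (towerParent m) C A).det| = 1 :=
  abs_det_forestMatrix_eq_one _ C A (towerRank m) (towerParent_rank_lt m) hA

/-- (v1.4) The letter-level form of the tower unipotency over an abstract finite-dimensional fibre. [folklore] -/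
theorem abs_linearMapDet_eq_one_of_tower_formula {V : Type*} [AddCommGroup V] [Module ℝ V] [FiniteDimensional ℝ V]
    (m : ℕ) (f : Module.End ℝ (TowerVertex d L m → V)) (Cx Ax : TowerVertex d L m → Module.End ℝ V)
    (hA : ∀ v, |LinearMap.det (Ax v)| = 1)
    (hf : ∀ (lam : TowerVertex d L m → V) (v : TowerVertex d L m),
      f lam v = (towerParent m v).elim 0 (fun w => Cx v (lam w)) - Ax v (lam v)) :
    |LinearMap.det f| = 1 :=
  abs_linearMapDet_eq_one_of_forest_formula' f (towerParent m) Cx Ax (towerRank m) (towerParent_rank_lt m) hA hf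

end Tower

end Literature.MathematicalPhysics.QuantumFieldTheory.Balaban1983to89.Beta.TreeSliceUnipotent
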